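import Literature.MathematicalPhysics.QuantumFieldTheory.Balaban1983to89.B11Eq174Chart

/-!
# `Balaban1983to89.B11Eq118RegimeRadii` — T. Bałaban, *The variational problem and background fields in renormalization group method for
# lattice gauge theories*, Commun. Math. Phys. **102** (1985) 277–309 [Balaban1985Variational] Prop. 6 (117)–(121) p. 295 and Sect. C (62)
# p. 288: THE SMALLNESS LETTERS OF THE TWO CONTRACTION REGIMES ARE JOINTLY SATISFIABLE — «for ε₁ sufficiently small» made explicit: given
# bounded operators `𝒢`, `H`, `H₁` and quadratic-analytic `W`, `C`, radii `j, a, ε₄, a_C, ε_C, R′, R_b > 0` inhabiting BOTH `Regime`s of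
# `B11Eq174Chart` together with the compatibility conditions of the composite chart (174)∘(47) EXIST

statement-level skeleton of published theorems with citation tags; proofs where landed; nothing here is a claim
about the Yang–Mills mass gap

PDF held: `paper:balaban1985-cmp102-variational-background` (journal page = PDF page + 276), pp. 288, 295 read by this seat (2026-08-21) through the
verbatim quotations of `B11Eq174Chart` / `B11Prop6Scheme` / `B13Contraction113`.

THE PRINT (verbatim, as quoted in `B11Eq174Chart`).  Prop. 6 p. 295: *«There exist constants … such that for ε₁ ≤ … the equation (116) has exactly
one solution in the space (115)»* with the conditions (118) `B₀C₁B₃ε₁ + B₀C₄(ε₄ + 2dLB₀C₁ε₁)² ≤ ε₄`, (121) `2(ε₄ + a) ≤ a₃`, `4B₀C₄(ε₄ + a) < 1`;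
Sect. C (62) p. 288: *«18C₂B₀ε₃ ≤ 1, ε₂ ≤ ¼ε₃»*.  The tree's `B11Eq174Chart.Regime 𝒢 Λ W B₀ θ C₄ a₃ j a ε₄` bundles exactly these letters
(`norm_G`, `norm_L`, `quad`, `dom`, `self`, `contr`); `Regime.ofProp6` derives it from Prop. 6's printed conditions.

WHY THIS FILE (cell context).  The pub-balaban NE9 route R2′ («`cur` by B11's displayed contractions») ends in
`Summits/…/Support/NE9B11ChartAnalytic.chartHB_triple_of_twoRegimes`, whose hypotheses are: a Sect. E/G `Regime 𝒢 Λ W B₀ θ C₄ a₃ j a ε₄`, a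
Sect. C `Regime H 0 C b 0 C₂ c₄ 0 a_C ε_C`, `W`/`C` analytic on their balls, `ε₄ + a ≤ a_C`, `‖H₁B‖ < a` on `ball 0 R_b`, and a chart radius
`R′ ≥ (ε₄ + a)/(1 − 4bC₂(ε_C + a_C))`.  The OPERATOR letters `𝒢 = 𝔊`, `H`, `H₁` are objects of the background (this lineage's `B11Eq103H1Complex`,
`B9Eq326OperatorAssembly`, `B9Eq315QTorusOnto`; leaf files `B11Eq45HOperatorLattice`), `W` and `C` with their `QuadAnalytic` constants are
the NE9 leaf seats' files in flight.  This file shows that the SCALAR letters then take care of themselves: on every finite lattice the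
operator norms `‖𝒢‖`, `‖H‖`, `‖H₁‖` are finite and the radii can be CHOSEN — print's «sufficiently small».  (What print proves and this file
does NOT: the UNIFORMITY of `B₀ = ‖𝔊‖`, `b = ‖H‖` in the lattice — [B9] Thms 3.12/3.13, displayed T-rows of the cell.)

WHAT IS PROVED (sorry-free; real arithmetic + operator norms; no `Prop` placeholder; no inequality of the paper asserted).
* `Regime.of_opNorm_zeroLinear` — `Regime 𝒢 0 W ‖𝒢‖ 0 C₄ a₃ j a ε₄` from the three scalar conditions `dom`/`self`/`contr` alone (θ = 0, B₀ := ‖𝒢‖).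
* **`exists_regime_radii`** — given `QuadAnalytic W C₄ a₃` (`0 ≤ C₄`, `0 < a₃`) and a cap `δ > 0`: `∃ j₀ a ε₄ > 0` with `ε₄ + a ≤ δ` and
  `Regime 𝒢 0 W ‖𝒢‖ 0 C₄ a₃ j a ε₄` for every current letter `0 ≤ j ≤ j₀`.
* **`exists_twoRegimes_radii`** — THE JOINT CHOICE matching `chartHB_triple_of_twoRegimes` letter for letter: `∃ j a ε₄ a_C ε_C R′ R_b`, all `> 0`,
  with `Regime 𝒢 0 W ‖𝒢‖ 0 C₄ a₃ j a ε₄`, `Regime H 0 C ‖H‖ 0 C₂ c₄ 0 a_C ε_C`, `ε₄ + a ≤ a_C`, `∀ B ∈ ball 0 R_b, ‖H₁ B‖ < a`, and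
  `(ε₄ + a)/(1 − 4‖H‖C₂(ε_C + a_C)) ≤ R′`.
MODEL / HONEST SCOPE.  Abstract complex normed spaces and continuous linear maps, as in `B11Eq174Chart`; EXISTENCE of admissible radii only
(non-uniform: the constants are the operator norms of the given maps); NOT summit progress (cell pub-balaban: NE9 NOT PRINTED / NOT PROVED; spine
PROVED 0/9).  Filed by the pub-balaban NE9 BINDER-row owner lineage `b2b-balaban-t4-ne9-p1` (gen 78); NEW file importing `B11Eq174Chart` only;
nothing modified.  Net new unproved facts: 0.
-/

noncomputable section

namespace Literature.MathematicalPhysics.QuantumFieldTheory.Balaban1983to89.B11Eq118RegimeRadii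

open Metric Set
open Literature.MathematicalPhysics.QuantumFieldTheory.Balaban1983to89
open Literature.MathematicalPhysics.QuantumFieldTheory.Balaban1983to89.B13Contraction113 (QuadAnalytic)
open Literature.MathematicalPhysics.QuantumFieldTheory.Balaban1983to89.B11Eq174Chart (Regime)

variable {𝒴 𝒵 : Type*} [NormedAddCommGroup 𝒴] [NormedSpace ℂ 𝒴] [NormedAddCommGroup 𝒵] [NormedSpace ℂ 𝒵]

/-- **A regime from the three scalar conditions** (θ = 0, `B₀ := ‖𝒢‖`): the operator bound `‖𝒢f‖ ≤ ‖𝒢‖‖f‖` is the operator norm's, the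
linear term is absent as in (116)/(175). [cite: Balaban1985Variational, Prop. 6 (117)–(121) p.295] -/
theorem Regime.of_opNorm_zeroLinear (𝒢 : 𝒵 →L[ℂ] 𝒴) {W : 𝒴 → 𝒵} {C₄ a₃ j a ε₄ : ℝ} (hW : QuadAnalytic W C₄ a₃) (hC₄ : 0 ≤ C₄)
    (hε₄ : 0 ≤ ε₄) (hdom : 2 * (ε₄ + a) ≤ a₃) (hself : ‖𝒢‖ * j + ‖𝒢‖ * C₄ * (ε₄ + a) ^ 2 ≤ ε₄) (hcontr : 4 * ‖𝒢‖ * C₄ * (ε₄ + a) < 1) :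
    Regime 𝒢 0 W ‖𝒢‖ 0 C₄ a₃ j a ε₄ :=
  ⟨fun f => 𝒢.le_opNorm f, fun Y => by simp, hW, norm_nonneg _, hC₄, le_rfl, hε₄, hdom, by simpa using hself, by simpa using hcontr⟩

/-- **The radii of ONE regime can be chosen** below any cap `δ > 0`, uniformly for all current letters `0 ≤ j ≤ j₀` with an explicit `j₀ > 0`:
`ε₄ := min(a₃/4, δ/2, 1/(16(‖𝒢‖C₄ + 1)))`, `a := ε₄`, `j₀ := ε₄/(4(‖𝒢‖ + 1))` — print's «for ε₁ sufficiently small».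
[cite: Balaban1985Variational, Prop. 6 (118), (121) p.295] -/
theorem exists_regime_radii (𝒢 : 𝒵 →L[ℂ] 𝒴) {W : 𝒴 → 𝒵} {C₄ a₃ : ℝ} (hW : QuadAnalytic W C₄ a₃) (hC₄ : 0 ≤ C₄) (ha₃ : 0 < a₃)
    {δ : ℝ} (hδ : 0 < δ) :
    ∃ j₀ a ε₄ : ℝ, 0 < j₀ ∧ 0 < a ∧ 0 < ε₄ ∧ ε₄ + a ≤ δ ∧ ∀ j, 0 ≤ j → j ≤ j₀ → Regime 𝒢 0 W ‖𝒢‖ 0 C₄ a₃ j a ε₄ := by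
  set B₀ : ℝ := ‖𝒢‖ with hB₀
  have hB₀0 : 0 ≤ B₀ := norm_nonneg _
  set ε₄ : ℝ := min (a₃ / 4) (min (δ / 2) (1 / (16 * (B₀ * C₄ + 1)))) with hε₄def
  have hK : 0 < B₀ * C₄ + 1 := by positivity
  have hε₄0 : 0 < ε₄ := by
    rw [hε₄def]; exact lt_min (by positivity) (lt_min (by positivity) (by positivity))
  have hε₄a : ε₄ ≤ a₃ / 4 := min_le_left _ _
  have hε₄δ : ε₄ ≤ δ / 2 := (min_le_right _ _).trans (min_le_left _ _)
  have hε₄K : ε₄ ≤ 1 / (16 * (B₀ * C₄ + 1)) := (min_le_right _ _).trans (min_le_right _ _)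
  have hprod : 16 * (B₀ * C₄) * ε₄ ≤ 1 := by
    have h1 : 16 * (B₀ * C₄ + 1) * ε₄ ≤ 1 := by
      rw [le_div_iff₀ (by positivity)] at hε₄K; linarith
    nlinarith
  refine ⟨ε₄ / (4 * (B₀ + 1)), ε₄, ε₄, by positivity, hε₄0, hε₄0, by linarith, fun j hj0 hj => ?_⟩
  refine Regime.of_opNorm_zeroLinear 𝒢 hW hC₄ hε₄0.le (by linarith) ?_ ?_
  · -- (118): `B₀ j + B₀C₄(2ε₄)² ≤ ε₄/4 + ε₄/4 ≤ ε₄`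
    have h1 : B₀ * j ≤ ε₄ / 4 := by
      have : B₀ * j ≤ B₀ * (ε₄ / (4 * (B₀ + 1))) := mul_le_mul_of_nonneg_left hj hB₀0
      refine this.trans ?_
      rw [mul_div_assoc', div_le_div_iff₀ (by positivity) (by positivity)]
      nlinarith
    have h2 : B₀ * C₄ * (ε₄ + ε₄) ^ 2 ≤ ε₄ / 4 := by nlinarith
    rw [← hB₀]; linarith
  · -- (121) second member: `4B₀C₄·2ε₄ ≤ 1/2 < 1`
    rw [← hB₀]; nlinarith

variable {𝒳 ℬ : Type*} [NormedAddCommGroup 𝒳] [NormedSpace ℂ 𝒳] [NormedAddCommGroup ℬ] [NormedSpace ℂ ℬ]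

/-- **THE JOINT CHOICE OF ALL SCALAR LETTERS OF THE COMPOSITE CHART (174)∘(47)** — letter for letter the scalar hypotheses of the cell's
`NE9B11ChartAnalytic.chartHB_triple_of_twoRegimes`: given bounded `𝒢`, `H`, `H₁` and quadratic-analytic `W` (constants `C₄, a₃`) and `C`
(constants `C₂, c₄`), there are radii with the Sect. E/G regime (`B₀ := ‖𝒢‖`, θ = 0), the Sect. C regime (`b := ‖H‖`, `j = 0`), the
compatibility `ε₄ + a ≤ a_C` («ε₂ ≤ ¼ε₃», (62)), the datum ball `‖H₁B‖ < a` for `‖B‖ < R_b` ((172)), and the chart radius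
`R′ = (ε₄ + a)/(1 − 4bC₂(ε_C + a_C))`. [cite: Balaban1985Variational, Prop. 6 (117)–(121) p.295, (62) p.288, (172) p.305] -/
theorem exists_twoRegimes_radii (𝒢 : 𝒵 →L[ℂ] 𝒴) {W : 𝒴 → 𝒵} {C₄ a₃ : ℝ} (hW : QuadAnalytic W C₄ a₃) (hC₄ : 0 ≤ C₄) (ha₃ : 0 < a₃)
    (H : 𝒳 →L[ℂ] 𝒴) {C : 𝒴 → 𝒳} {C₂ c₄ : ℝ} (hC : QuadAnalytic C C₂ c₄) (hC₂ : 0 ≤ C₂) (hc₄ : 0 < c₄) (H₁ : ℬ →L[ℂ] 𝒴) :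
    ∃ j a ε₄ aC εC R' Rb : ℝ, 0 < j ∧ 0 < a ∧ 0 < ε₄ ∧ 0 < aC ∧ 0 < εC ∧ 0 < R' ∧ 0 < Rb ∧
      Regime 𝒢 0 W ‖𝒢‖ 0 C₄ a₃ j a ε₄ ∧ Regime H 0 C ‖H‖ 0 C₂ c₄ 0 aC εC ∧ ε₄ + a ≤ aC ∧
      (∀ B ∈ ball (0 : ℬ) Rb, ‖H₁ B‖ < a) ∧ 1 / (1 - 4 * ‖H‖ * C₂ * (εC + aC)) * (ε₄ + a) ≤ R' := by
  -- Sect. C radii first (any cap), then Sect. E/G radii under the cap `a_C`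
  obtain ⟨j₁, aC, εC, hj₁, haC, hεC, -, hRC⟩ := exists_regime_radii H hC hC₂ hc₄ one_pos
  have RC : Regime H 0 C ‖H‖ 0 C₂ c₄ 0 aC εC := hRC 0 le_rfl hj₁.le
  obtain ⟨j₀, a, ε₄, hj₀, ha, hε₄, hcap, hR⟩ := exists_regime_radii 𝒢 hW hC₄ ha₃ haC
  have R : Regime 𝒢 0 W ‖𝒢‖ 0 C₄ a₃ j₀ a ε₄ := hR j₀ hj₀.le le_rfl
  have hden : 0 < 1 - 4 * ‖H‖ * C₂ * (εC + aC) := by linarith [RC.contr]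
  set R' : ℝ := 1 / (1 - 4 * ‖H‖ * C₂ * (εC + aC)) * (ε₄ + a) with hR'
  have hR'0 : 0 < R' := by positivity
  set Rb : ℝ := a / (‖H₁‖ + 1) with hRb
  have hRb0 : 0 < Rb := by positivity
  refine ⟨j₀, a, ε₄, aC, εC, R', Rb, hj₀, ha, hε₄, haC, hεC, hR'0, hRb0, R, RC, hcap, fun B hB => ?_, le_rfl⟩
  rw [mem_ball_zero_iff] at hB
  have h1 : ‖H₁ B‖ ≤ ‖H₁‖ * ‖B‖ := H₁.le_opNorm B
  have h2 : ‖H₁‖ * ‖B‖ ≤ ‖H₁‖ * Rb := mul_le_mul_of_nonneg_left hB.le (norm_nonneg _)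
  have h3 : ‖H₁‖ * Rb < a := by
    rw [hRb, mul_div_assoc', div_lt_iff₀ (by positivity)]
    nlinarith [norm_nonneg H₁]
  linarith

end Literature.MathematicalPhysics.QuantumFieldTheory.Balaban1983to89.B11Eq118RegimeRadii

end
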